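import Mathlib
import HarnessLib
import Summits.NavierStokesRegularity.NavierStokesRegularity.Theorems.UnthreadedDoorCellFluxDefs
import Literature.Analysis.PDE.BanachIndicatrixLaplacianBound

/-!
# Route `UnthreadedDoor`, crux `PoloidalLiouville` (stmt-NavierStokesRegularity-1222), WALL W1 — crux idea «indicatrix-bound», Λ-0a:
# the cluster oscillation sum is majorised by the Banach indicatrix (M Lean bridge from Λ-geo″)

★ `clusterOscLeIndicatrix_of : <Λ-geo″ `AnalyticCriticalValuesFinite` body verbatim> → ∀ x₀ f r 𝒦, 0 < r → AnalyticOnNhd ℝ f {x₀}ᶜ →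
IsClusterPartition f x₀ r 𝒦 → (∀ K ∈ 𝒦, IsPreconnected (f '' K)) → ENNReal.ofReal (∑ᶠ K ∈ 𝒦, setOsc f K) ≤ banachIndicatrix (sphere x₀ r) f` — the
registered stub `stub_clusterOscLeIndicatrix : AnalyticCriticalValuesFinite → ClusterOscLeIndicatrix` of `Cruxes/PoloidalLiouville/IndicatrixSketch.lean`
v1.7.3 (custodian ns-idea-14), both Props unfolded (the sketch's `indicatrix` IS `Literature.Analysis.PDE.banachIndicatrix` by its kernel lemma
`indicatrix_eq_banachIndicatrix`, `rfl`; `sphCrit`/`setOsc`/`cellSet`/`IsClusterPartition` are the CellFlux Defs twin's, p692073), so the sketch closes it by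
the bare term.

Proof (the sketch's §Λ-0′ recipe): for a level `τ` OFF the finite set of sphere-critical values, the level set `S_r ∩ f⁻¹{τ}` misses `sphCrit ⊇ sheetTrace`,
so each of its connected components is a preconnected subset of `S_r ∖ Γ`, hence inside ONE cell, hence inside ONE class; a class `K` with
`sInf f(K) < τ < sSup f(K)` has a point `y_K ∈ K` with `f y_K = τ` (its range is preconnected: `IsConnected.Ioo_csInf_csSup_subset`), and `K ↦ component of y_K` is injective (classes are
pairwise disjoint) — so `#{K : τ ∈ (sInf f(K), sSup f(K))} ≤ β₀(S_r ∩ f⁻¹{τ})` for a.e. `τ`; integrating, `ofReal (Σ_K osc_K) = Σ_K volume (sInf, sSup)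
= ∫⁻ Σ_K 𝟙 ≤ ∫⁻ β₀ = Λ`.  Pure topology + measure bookkeeping; nothing here is an NS statement; ⟨1222⟩ / W1 / NS regularity OPEN.
`--supports stmt-NavierStokesRegularity-1222 --as helper`.  [folklore]
-/

noncomputable section

-- the summit and its single sub-problem share the name (CONVENTIONS §1)
set_option linter.dupNamespace false

open Set Function Filter Topology MeasureTheory
open scoped RealInnerProductSpace ENNReal

namespace Summit.NavierStokesRegularity.NavierStokesRegularity.Theorems.PoloidalLiouville.Indicatrix

open Summit.NavierStokesRegularity.NavierStokesRegularity.Theorems.PoloidalLiouville.NetFlux (E3)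
open Summit.NavierStokesRegularity.NavierStokesRegularity.Theorems.PoloidalLiouville.CellFlux
  (sphCrit sheetTrace cellOf cellSet setOsc IsClusterPartition)
open Literature.Analysis Literature.Analysis.FluidPDE Literature.Analysis.PDE

/-- **The counting step at a non-critical level.**  For a cluster partition `𝒦` of `S_r(x₀) ∖ Γ` and a level `τ` that is not a sphere-critical value,
the number of classes `K` containing a point of the level set `{f = τ}` is at most the number of connected components of `S_r ∩ f⁻¹{τ}`. [folklore] -/
theorem card_le_levelComponentCount {x₀ : E3} {f : E3 → ℝ} {r τ : ℝ} {𝒦 : Set (Set E3)}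
    (hpart : IsClusterPartition f x₀ r 𝒦) (hτ : τ ∉ f '' sphCrit f x₀ r) (G : Finset (Set E3)) (hG : ↑G ⊆ 𝒦)
    (hy : ∀ K ∈ G, ∃ y ∈ K, f y = τ) :
    ((G.card : ℕ∞) : ℝ≥0∞) ≤ ((levelComponentCount (Metric.sphere x₀ r) f τ : ℕ∞) : ℝ≥0∞) := by
  obtain ⟨-, hcls, hcover, hdisj⟩ := hpart
  set S : Set E3 := Metric.sphere x₀ r with hS
  set L : Set E3 := S ∩ f ⁻¹' {τ} with hL
  choose! y hyK hyf using hy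
  -- every class is inside the sphere minus the sheet traces
  have hKsub : ∀ K ∈ 𝒦, K ⊆ S \ sheetTrace f x₀ r := fun K hK x hx => by
    rw [← hcover]; exact mem_sUnion_of_mem hx hK
  -- the cell of a point of a class lies inside the class
  have hcell : ∀ K ∈ 𝒦, ∀ x ∈ K, cellOf f x₀ r x ⊆ K := by
    intro K hK x hx
    obtain ⟨-, 𝒪, h𝒪, rfl⟩ := hcls K hK
    obtain ⟨O, hO, hxO⟩ := mem_sUnion.1 hx
    obtain ⟨z, -, rfl⟩ := h𝒪 hO
    have heq : cellOf f x₀ r z = cellOf f x₀ r x := connectedComponentIn_eq hxO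
    rw [← heq]
    exact subset_sUnion_of_mem hO
  -- the component of `y K` in the level set lies inside the cell of `y K`
  have hcomp : ∀ K ∈ G, connectedComponentIn L (y K) ⊆ cellOf f x₀ r (y K) := by
    intro K hK
    have hyS : y K ∈ S := (hKsub K (hG hK) (hyK K hK)).1
    refine (isPreconnected_connectedComponentIn).subset_connectedComponentIn
      (mem_connectedComponentIn ⟨hyS, hyf K hK⟩) fun z hz => ?_
    have hzL : z ∈ L := connectedComponentIn_subset _ _ hz
    refine ⟨hzL.1, fun hzΓ => hτ ?_⟩
    exact ⟨z, hzΓ.1, hzL.2⟩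
  -- the map `K ↦ component of y K` is injective on `G` and lands in the component set
  have hinj : Set.InjOn (fun K => connectedComponentIn L (y K)) ↑G := by
    intro K hK K' hK' hKK'
    have hK𝒦 : K ∈ 𝒦 := hG hK
    have hK'𝒦 : K' ∈ 𝒦 := hG hK'
    have hyS' : y K' ∈ S := (hKsub K' hK'𝒦 (hyK K' hK')).1
    have h1 : y K' ∈ connectedComponentIn L (y K) := by
      have h := mem_connectedComponentIn (x := y K') (F := L) ⟨hyS', hyf K' hK'⟩
      simp only at hKK'
      rwa [← hKK'] at h
    have h2 : y K' ∈ K := hcell K hK𝒦 (y K) (hyK K hK) (hcomp K hK h1)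
    by_contra hne
    exact (Set.disjoint_iff.1 (hdisj hK𝒦 hK'𝒦 hne)) ⟨h2, hyK K' hK'⟩
  have hmaps : (fun K => connectedComponentIn L (y K)) '' ↑G ⊆ connectedComponentIn L '' L := by
    rintro _ ⟨K, hK, rfl⟩
    exact ⟨y K, ⟨(hKsub K (hG hK) (hyK K hK)).1, hyf K hK⟩, rfl⟩
  have hcard : ((G.card : ℕ∞)) ≤ levelComponentCount (Metric.sphere x₀ r) f τ := by
    unfold levelComponentCount
    rw [← Set.encard_coe_eq_coe_finsetCard, ← hinj.encard_image]
    exact Set.encard_le_encard hmaps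
  exact ENat.toENNReal_le.2 hcard

/-- ★ **Λ-0a as a bridge from Λ-geo″**: the finiteness of sphere-critical values of analytic slices (the body of `AnalyticCriticalValuesFinite`, verbatim)
implies that the cluster oscillation sum of every cluster partition with preconnected class ranges is majorised by the Banach indicatrix of the slice (the
body of `ClusterOscLeIndicatrix`, verbatim, with `indicatrix = Literature.Analysis.PDE.banachIndicatrix`). [folklore] -/
theorem clusterOscLeIndicatrix_of
    (hCV : ∀ (x₀ : E3) (f : E3 → ℝ) (r : ℝ), 0 < r → AnalyticOnNhd ℝ f ({x₀}ᶜ : Set E3) → (f '' sphCrit f x₀ r).Finite) :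
    ∀ (x₀ : E3) (f : E3 → ℝ) (r : ℝ) (𝒦 : Set (Set E3)), 0 < r → AnalyticOnNhd ℝ f ({x₀}ᶜ : Set E3) →
      IsClusterPartition f x₀ r 𝒦 → (∀ K ∈ 𝒦, IsPreconnected (f '' K)) →
      ENNReal.ofReal (∑ᶠ K ∈ 𝒦, setOsc f K) ≤ banachIndicatrix (Metric.sphere x₀ r) f := by
  intro x₀ f r 𝒦 hr hf hpart hpre
  have hfin : 𝒦.Finite := hpart.1
  obtain ⟨_, hcls, hcover, hdisj⟩ := hpart
  set S : Set E3 := Metric.sphere x₀ r with hS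
  -- the image of the sphere is compact; classes are nonempty subsets of the sphere
  have hsph : S ⊆ ({x₀}ᶜ : Set E3) := fun x hx => Metric.ne_of_mem_sphere hx hr.ne'
  have hcont : ContinuousOn f S := hf.continuousOn.mono hsph
  have hcpt : IsCompact (f '' S) := (isCompact_sphere x₀ r).image_of_continuousOn hcont
  have hKsub : ∀ K ∈ 𝒦, K ⊆ S := fun K hK x hx => by
    have h : x ∈ ⋃₀ 𝒦 := mem_sUnion_of_mem hx hK
    rw [hcover] at h
    exact h.1
  have hbddA : ∀ K ∈ 𝒦, BddAbove (f '' K) := fun K hK => hcpt.bddAbove.mono (image_mono (hKsub K hK))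
  have hbddB : ∀ K ∈ 𝒦, BddBelow (f '' K) := fun K hK => hcpt.bddBelow.mono (image_mono (hKsub K hK))
  have hne : ∀ K ∈ 𝒦, (f '' K).Nonempty := fun K hK => (hcls K hK).1.image f
  have hosc : ∀ K ∈ 𝒦, 0 ≤ setOsc f K := fun K hK => by
    obtain ⟨v, hv⟩ := hne K hK
    have h := (csInf_le (hbddB K hK) hv).trans (le_csSup (hbddA K hK) hv)
    show 0 ≤ sSup (f '' K) - sInf (f '' K)
    linarith
  -- (1) the left-hand side as a lower integral of a sum of indicators
  set F : Finset (Set E3) := hfin.toFinset with hF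
  have hF𝒦 : ∀ K ∈ F, K ∈ 𝒦 := fun K hK => hfin.mem_toFinset.1 hK
  have hlhs : ENNReal.ofReal (∑ᶠ K ∈ 𝒦, setOsc f K)
      = ∫⁻ τ, ∑ K ∈ F, (Ioo (sInf (f '' K)) (sSup (f '' K))).indicator (1 : ℝ → ℝ≥0∞) τ := by
    rw [finsum_mem_eq_finite_toFinset_sum _ hfin, ENNReal.ofReal_sum_of_nonneg (fun K hK => hosc K (hF𝒦 K hK)),
      lintegral_finsetSum _ (fun K _ => measurable_one.indicator measurableSet_Ioo)]
    refine Finset.sum_congr rfl fun K hK => ?_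
    rw [lintegral_indicator_one measurableSet_Ioo, Real.volume_Ioo]
    rfl
  rw [hlhs, banachIndicatrix_eq]
  -- (2) the a.e. pointwise comparison off the finite set of critical values
  have hae : ∀ᵐ τ ∂(volume : Measure ℝ), τ ∉ f '' sphCrit f x₀ r :=
    measure_eq_zero_iff_ae_notMem.1 ((hCV x₀ f r hr hf).measure_zero volume)
  refine lintegral_mono_ae (hae.mono fun τ hτ => ?_)
  -- the sum of indicators is the number of classes whose open range contains `τ`
  set G : Finset (Set E3) := F.filter (fun K => τ ∈ Ioo (sInf (f '' K)) (sSup (f '' K))) with hG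
  have hsum : ∑ K ∈ F, (Ioo (sInf (f '' K)) (sSup (f '' K))).indicator (1 : ℝ → ℝ≥0∞) τ = ((G.card : ℕ∞) : ℝ≥0∞) := by
    simp only [Set.indicator_apply, Pi.one_apply, Finset.sum_boole, hG, ENat.toENNReal_coe]
  rw [hsum]
  refine card_le_levelComponentCount ⟨hfin, hcls, hcover, hdisj⟩ hτ G
    (fun K hK => hF𝒦 K (Finset.mem_filter.1 hK).1) fun K hK => ?_
  -- a class whose open range contains `τ` meets the level set `{f = τ}` (its range is preconnected)
  obtain ⟨hKF, hτK⟩ := Finset.mem_filter.1 hK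
  have hK𝒦 : K ∈ 𝒦 := hF𝒦 K hKF
  obtain ⟨y, hyK, hyτ⟩ := (IsConnected.Ioo_csInf_csSup_subset ⟨hne K hK𝒦, hpre K hK𝒦⟩ (hbddB K hK𝒦) (hbddA K hK𝒦)) hτK
  exact ⟨y, hyK, hyτ⟩

end Summit.NavierStokesRegularity.NavierStokesRegularity.Theorems.PoloidalLiouville.Indicatrix

end
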